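import Mathlib
import HarnessLib
import Summits.Ventures.LatticeQCDFlow.TrivializingMaps.GradedTheoremA
import Summits.Ventures.LatticeQCDFlow.TrivializingMaps.DrivenSeriesUniqueness

/-!
HONEST FRAMING: exact (Metropolis-corrected) sampling algorithms for lattice gauge theory; figures of
merit are autocorrelation/cost numbers at stated couplings and volumes; no continuum-physics claim.
A statement about Lüscher's formal power series on finite periodic lattices, not a continuum claim.

# The ANCHORED form of THEOREM A (cell pub-lqcd, row 30 lean-1 GEN-3; OURS)

`TheoremAReduction.lean` (theory-1, row 32) filed the per-anchor form of Theorem A as a second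
`@[conjecture]` node, `LuscherAnchoredGeometricBound d n B₀`: the anchored terms
`G^{(k)}_{e₀} = anchTerm B₀ k e₀` of the tree's constructed Lüscher series
`wilsonSk d L B₀ k = ∑_{e₀} anchTerm B₀ k e₀` (`LuscherSeriesExistence.lean`: `G^{(0)}_{e₀}` solves
`Δ G = s_{e₀} - ⟨s_{e₀}⟩` for the anchored plaquette sum `s_{e₀} = anchorS e₀`, and
`G^{(k+1)}_{e₀} = Δ⁻¹(-(∑ ∂S_W·∂G^{(k)}_{e₀}) + const)`) obey `|∂^a_e G^{(k)}_{e₀}(ιU)| ≤ C ρ^{-k}` with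
`ρ, C` independent of the lattice size.  It is NOT a formal consequence of Theorem A (a bound on the sum
over anchors does not bound the summands), and it is the LOCAL form of the result: each `G^{(k)}_{e₀}`
lives on the plaquette ball `linkBall (k+1) e₀` (`anchTerm_mem`), so the anchored bound says the exact
generator `-∂S̃` is a sum of exponentially small, finitely supported pieces.

This file PROVES it (`luscherAnchoredGeometricBound_holds`), with the constants of `GradedTheoremA`
(`ρ = 1/θ₁`, `C = N₀`), by splitting theory-1's graded series (rows 52–58) along ROOTS:

* (`DrivenSeriesUniqueness.lean`) `linkDeriv_eq_of_driven` — uniqueness of link gradients for recursions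
  DRIVEN by `S_W` with an arbitrary order-`0` source (here `s_{e₀}`).
* §1 `root B k i` — the anchor link `(x, μ)` of the plaquette `(x, μ, ν)` at the bottom of the ancestry of
  the generation-`k` datum `i`; `anchSk B k e₀ = ∑_{root i = e₀} termᵢ` — the anchored graded series;
  `∑_{e₀} anchSk B k e₀ = gradedSk B k`.
* §2 the anchored graded series solves the anchored recursion on the field manifold
  (`linkLap_anchSk_zero_coeConfig`, `linkLap_anchSk_succ_coeConfig`: the proofs of rows 53's
  `linkLap_gen0_func_coeConfig` / `linkLap_step_func_coeConfig` restricted to one root), hence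
  (§3) `linkDeriv_anchTerm_eq`: `∂^a_e G^{(k)}_{e₀}(ιU) = ∂^a_e (anchSk B₀ k e₀)(ιU)`.
* §4 `|∂^a_e (anchSk B k e₀)(ιU)| ≤ N_{G_k}(e) ≤ N₀ θ₁^k` (a sub-sum of row 54's link mass, bounded by
  row 58's `mass_pack_le`), and the conjecture node.

References: M. Lüscher, Commun. Math. Phys. 293 (2010) 899 [arXiv:0907.5491], §4.3 eqs. (4.13)–(4.15),
§4.4, §4.5(b); THEORY-1.md §12.5, §16.8, §19.  Tags: [ours] = venture bookkeeping.
-/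

noncomputable section

namespace Summit.Ventures.LatticeQCDFlow.TrivializingMaps.GradedSeries

open scoped ComplexConjugate Matrix Matrix.Norms.Frobenius InnerProductSpace ContDiff
open Finset MeasureTheory
open Literature.MathematicalPhysics.QuantumFieldTheory
open Literature.MathematicalPhysics.QuantumFieldTheory.Luscher2010
open SlotRepresentation SlotCasimir SlotCoefficient SlotHilbert JointGrading CasimirGrading PlaquetteData
  SlotTensor TensorShift RankOne Vertex

variable {d L n : ℕ} [NeZero L]

/-! ## §1. Roots and the anchored graded series -/

/-- The ROOT of a generation-`k` datum: the anchor link `(x, μ)` of the plaquette `(x, μ, ν)` whose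
re-graded term (generation `0`) it descends from. [ours] -/
def root (B : SuBasis n) : (k : ℕ) → (pack (d := d) (L := L) B k).G.I → Edge d L
  | 0, j => ((show Idx0 (d := d) (L := L) B from j).1.1.1, (show Idx0 (d := d) (L := L) B from j).1.1.2.1)
  | k + 1, j => root B k (show (pack (d := d) (L := L) B k).G.CIdx from j).2.2.1

/-- Root of a generation-`0` datum `⟨((x, μ, ν), c), m⟩` is `(x, μ)`. [ours] -/
theorem root_zero (B : SuBasis n) (j : Idx0 (d := d) (L := L) B) :
    root B 0 j = (j.1.1.1, j.1.1.2.1) := rfl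

/-- Root of a child is the root of its parent. [ours] -/
theorem root_succ (B : SuBasis n) (k : ℕ) (j : (pack (d := d) (L := L) B k).G.CIdx) :
    root B (k + 1) j = root B k j.2.2.1 := rfl

/-- **The anchored graded series** `G'^{(k)}_{e₀} := ∑_{root i = e₀} termᵢ` (the part of `S̃^{(k)}` grown
from the plaquettes anchored at `e₀`). [ours] -/
def anchSk (B : SuBasis n) (k : ℕ) (e₀ : Edge d L) : AmbConfig d L n → ℝ := fun W =>
  ∑ i ∈ Finset.univ.filter (fun i => root B k i = e₀), (pack (d := d) (L := L) B k).G.term i W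

/-- The anchored pieces sum to the graded series: `∑_{e₀} G'^{(k)}_{e₀} = S̃^{(k)}`. [ours] -/
theorem sum_anchSk (B : SuBasis n) (k : ℕ) (W : AmbConfig d L n) :
    ∑ e₀ : Edge d L, anchSk B k e₀ W = gradedSk (d := d) (L := L) B k W := by
  unfold anchSk
  rw [Finset.sum_fiberwise Finset.univ (root B k) fun i => (pack (d := d) (L := L) B k).G.term i W]
  rfl

/-- Every anchored piece is smooth on the ambient space. [ours] -/
theorem contDiff_anchSk (B : SuBasis n) (k : ℕ) (e₀ : Edge d L) :
    ContDiff ℝ ∞ (anchSk (d := d) (L := L) B k e₀) :=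
  ContDiff.sum fun i _ => (pack (d := d) (L := L) B k).G.contDiff_term i

/-- `Δ` of an anchored piece, everywhere: `∑_{root i = e₀} c(mᵢ) termᵢ`. [ours] -/
theorem linkLap_anchSk (B : SuBasis n) (k : ℕ) (e₀ : Edge d L) (W : AmbConfig d L n) :
    linkLap B (anchSk (d := d) (L := L) B k e₀) W =
      ∑ i ∈ Finset.univ.filter (fun i => root B k i = e₀),
        (pack (d := d) (L := L) B k).G.cm i * (pack (d := d) (L := L) B k).G.term i W := by
  have h := congrFun (linkLap_finset_sum B (Finset.univ.filter (fun i => root B k i = e₀))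
    (fun i => (pack (d := d) (L := L) B k).G.term i)
    fun i _ => (pack (d := d) (L := L) B k).G.contDiff_term i) W
  rw [show anchSk (d := d) (L := L) B k e₀ = fun W => ∑ i ∈ Finset.univ.filter (fun i => root B k i = e₀),
      (pack (d := d) (L := L) B k).G.term i W from rfl, h]
  exact Finset.sum_congr rfl fun i _ => linkLap_termF_jointProj _ _ B _ _ _ _ W

/-- Link derivative of an anchored piece: the sum of the link derivatives of its terms. [ours] -/
theorem linkDeriv_anchSk (B : SuBasis n) (k : ℕ) (e₀ e : Edge d L) (a : B.ι) (W : AmbConfig d L n) :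
    linkDeriv e (B.T a) (anchSk (d := d) (L := L) B k e₀) W =
      ∑ i ∈ Finset.univ.filter (fun i => root B k i = e₀),
        linkDeriv e (B.T a) ((pack (d := d) (L := L) B k).G.term i) W := by
  have h := congrFun (linkDeriv_finset_sum e (B.T a) (Finset.univ.filter (fun i => root B k i = e₀))
    (fun i => (pack (d := d) (L := L) B k).G.term i)
    fun i _ => (pack (d := d) (L := L) B k).G.contDiff_term i) W
  rw [show anchSk (d := d) (L := L) B k e₀ = fun W => ∑ i ∈ Finset.univ.filter (fun i => root B k i = e₀),
      (pack (d := d) (L := L) B k).G.term i W from rfl, h]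

/-! ## §2. The anchored graded series solves the anchored recursion on `SU(n)^E` -/

section Base
variable (B : SuBasis n)

/-- Per-term form of `Δ` at generation `0`: `c(m) · term = [μ<ν](c(m) ≠ 0 ? -baseF : 0)`. [ours] -/
theorem cm_mul_term_gen0 (j : Idx0 (d := d) (L := L) B) (W : AmbConfig d L n) :
    (gen0 (d := d) (L := L) B).cm j * (gen0 (d := d) (L := L) B).term j W =
      if j.1.1.2.1 < j.1.1.2.2 then (if (gen0 (d := d) (L := L) B).cm j = 0 then 0 else -baseF B j W)
      else 0 := by
  have hz : (((gen0 (d := d) (L := L) B).cm j : ℝ) : ℂ) * (gen0 (d := d) (L := L) B).z j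
      = if j.1.1.2.1 < j.1.1.2.2 then (if (gen0 (d := d) (L := L) B).cm j = 0 then 0 else -1) else 0 := by
    show ((modeC (plaqIdx j.1.1.1 j.1.1.2.1 j.1.1.2.2) plaqPol B j.2 : ℝ) : ℂ)
        * (if j.1.1.2.1 < j.1.1.2.2 then zneg (modeC (plaqIdx j.1.1.1 j.1.1.2.1 j.1.1.2.2) plaqPol B j.2)
          else 0)
      = if j.1.1.2.1 < j.1.1.2.2 then
          (if modeC (plaqIdx j.1.1.1 j.1.1.2.1 j.1.1.2.2) plaqPol B j.2 = 0 then 0 else -1) else 0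
    by_cases h1 : j.1.1.2.1 < j.1.1.2.2
    · rw [if_pos h1, if_pos h1]; exact ofReal_mul_zneg _
    · rw [if_neg h1, if_neg h1, mul_zero]
  rw [Gen.term, ← termF_real_mul_left, hz]
  split_ifs with h1 h2
  · exact Gen.termF_zero_left _ _ _ _ W
  · exact termF_neg_one_left _ _ _ _ W
  · exact Gen.termF_zero_left _ _ _ _ W

/-- Sums over the generation-`0` data with a given root `e₀ = (x, μ)`: iterate over `ν`, the colour cycle
and the mode of the plaquette `(x, μ, ν)`. [ours] -/
theorem sum_filter_root_zero (e₀ : Edge d L) (g : Idx0 (d := d) (L := L) B → ℝ) :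
    ∑ j ∈ Finset.univ.filter (fun j : Idx0 (d := d) (L := L) B => root B 0 j = e₀), g j =
      ∑ ν : Fin d, ∑ c : Fin n × Fin n × Fin n × Fin n,
        ∑ mo : Modes (casimirFamily (plaqIdx (d := d) (L := L) e₀.1 e₀.2 ν) plaqPol B),
          g ⟨((e₀.1, e₀.2, ν), c), mo⟩ := by
  rw [Finset.sum_filter]
  show (∑ j : Idx0 (d := d) (L := L) B, if root B 0 j = e₀ then g j else 0) = _
  rw [sum_Idx0 B]
  obtain ⟨x₀, μ₀⟩ := e₀
  have h : ∀ p : Site d L × Fin d × Fin d,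
      (∑ c : Fin n × Fin n × Fin n × Fin n,
        ∑ mo : Modes (casimirFamily (plaqIdx (d := d) (L := L) p.1 p.2.1 p.2.2) plaqPol B),
          if root B 0 ⟨(p, c), mo⟩ = (x₀, μ₀) then g ⟨(p, c), mo⟩ else 0) =
      if p.1 = x₀ ∧ p.2.1 = μ₀ then ∑ c : Fin n × Fin n × Fin n × Fin n,
        ∑ mo : Modes (casimirFamily (plaqIdx (d := d) (L := L) p.1 p.2.1 p.2.2) plaqPol B),
          g ⟨(p, c), mo⟩ else 0 := by
    intro p
    simp only [root_zero, Prod.mk.injEq]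
    split_ifs with hp
    · rfl
    · simp
  rw [Finset.sum_congr rfl fun p _ => h p, Fintype.sum_prod_type,
    Finset.sum_eq_single_of_mem x₀ (Finset.mem_univ _) fun x _ hx =>
      Finset.sum_eq_zero fun q _ => if_neg fun hq => hx hq.1,
    Fintype.sum_prod_type,
    Finset.sum_eq_single_of_mem μ₀ (Finset.mem_univ _) fun μ _ hμ =>
      Finset.sum_eq_zero fun ν _ => if_neg fun hq => hμ hq.2]
  refine Finset.sum_congr rfl fun ν _ => ?_
  rw [if_pos ⟨rfl, rfl⟩]

/-- The constant of the anchored base case: `-(#{ν > μ})·n + ∑_{zero modes, root e₀} baseF(𝟙)`. [ours] -/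
def anchConst0 (e₀ : Edge d L) : ℝ :=
  -(∑ ν : Fin d, if e₀.2 < ν then (n : ℝ) else 0)
    + ∑ j ∈ Finset.univ.filter (fun j : Idx0 (d := d) (L := L) B => root B 0 j = e₀), if j.1.1.2.1 < j.1.1.2.2 then
        (if (gen0 (d := d) (L := L) B).cm j = 0 then baseF B j (WilsonFlow.coeConfig fun _ => 1) else 0)
      else 0

/-- The anchored plaquette sum on the field manifold, re-graded:
`s_{e₀}(ιU) = ∑_{ν > μ} (n - ∑_c ∑_m baseF_{((x,μ,ν),c,m)}(ιU))`. [ours] -/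
theorem anchorS_coeConfig_eq (e₀ : Edge d L) (U : GaugeConfig d L (Matrix.specialUnitaryGroup (Fin n) ℂ)) :
    anchorS e₀ (WilsonFlow.coeConfig U) =
      (∑ ν : Fin d, if e₀.2 < ν then (n : ℝ) else 0)
        - ∑ j ∈ Finset.univ.filter (fun j : Idx0 (d := d) (L := L) B => root B 0 j = e₀),
            if j.1.1.2.1 < j.1.1.2.2 then baseF B j (WilsonFlow.coeConfig U) else 0 := by
  rw [sum_filter_root_zero B e₀, ← Finset.sum_sub_distrib, anchorS, Finset.sum_filter]
  refine Finset.sum_congr rfl fun ν _ => ?_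
  split_ifs with hν
  · rw [plaqRe_eq_sub_coeff, sub_right_inj]
    show (coeffC _ _ (plaqKer n) (WilsonFlow.coeConfig U)).re = _
    rw [plaqKer, coeffC_sum, Complex.re_sum]
    refine Finset.sum_congr rfl fun c _ => ?_
    rw [← rank1_pv, coeffC_rank1, ← one_mul ⟪_, _⟫_ℂ, ← termF_apply]
    simp only [baseF, gen0, Gen.y]
    exact termF_coeConfig_eq_sum _ _ B _ _ _ U
  · simp

/-- **Anchored base case on the field manifold**: `Δ G'^{(0)}_{e₀}(ιU) = s_{e₀}(ιU) + const`. [ours] -/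
theorem linkLap_anchSk_zero_coeConfig (e₀ : Edge d L)
    (U : GaugeConfig d L (Matrix.specialUnitaryGroup (Fin n) ℂ)) :
    linkLap B (anchSk (d := d) (L := L) B 0 e₀) (WilsonFlow.coeConfig U)
      = anchorS e₀ (WilsonFlow.coeConfig U) + anchConst0 (d := d) (L := L) B e₀ := by
  rw [linkLap_anchSk, anchorS_coeConfig_eq B e₀ U, anchConst0]
  have hterm : ∀ j : Idx0 (d := d) (L := L) B,
      (gen0 (d := d) (L := L) B).cm j * (gen0 (d := d) (L := L) B).term j (WilsonFlow.coeConfig U)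
        = -(if j.1.1.2.1 < j.1.1.2.2 then baseF B j (WilsonFlow.coeConfig U) else 0)
          + (if j.1.1.2.1 < j.1.1.2.2 then
              (if (gen0 (d := d) (L := L) B).cm j = 0 then baseF B j (WilsonFlow.coeConfig fun _ => 1) else 0)
            else 0) := by
    intro j
    rw [cm_mul_term_gen0 B j]
    by_cases h1 : j.1.1.2.1 < j.1.1.2.2
    · by_cases h2 : (gen0 (d := d) (L := L) B).cm j = 0
      · rw [if_pos h1, if_pos h1, if_pos h1, if_pos h2, if_pos h2, baseF_coeConfig_eq_of_cm_eq_zero B j h2 U,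
          neg_add_cancel]
      · rw [if_pos h1, if_pos h1, if_pos h1, if_neg h2, if_neg h2, add_zero]
    · rw [if_neg h1, if_neg h1, if_neg h1, neg_zero, add_zero]
  show ∑ j ∈ Finset.univ.filter (fun j : Idx0 (d := d) (L := L) B => root B 0 j = e₀),
      (gen0 (d := d) (L := L) B).cm j * (gen0 (d := d) (L := L) B).term j (WilsonFlow.coeConfig U) = _
  rw [Finset.sum_congr rfl fun j _ => hterm j, Finset.sum_add_distrib, Finset.sum_neg_distrib]
  ring

end Base

section Step
variable (B : SuBasis n)

/-- Per-term form of `Δ` at the next generation: `c(m') · term = (c(m') ≠ 0 ? childF : 0)`. [ours] -/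
theorem cm_mul_term_step {σ : Type} [Fintype σ] [DecidableEq σ] (G : Gen (d := d) (L := L) B σ)
    (j : G.CIdx) (W : AmbConfig d L n) :
    G.step.cm j * G.step.term j W = if G.step.cm j = 0 then 0 else G.childF j W := by
  rw [Gen.term, ← termF_real_mul_left,
    show ((G.step.cm j : ℝ) : ℂ) * G.step.z j = if G.step.cm j = 0 then 0 else G.zhalf j.2.2.1 j.2.2.2.1 from
      Gen.ofReal_mul_zdiv _ _]
  split_ifs with h
  · exact Gen.termF_zero_left _ _ _ _ W
  · rfl

/-- Sums over the children with parents in a set `s`, iterated. [ours] -/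
theorem sum_filter_parent {σ : Type} [Fintype σ] [DecidableEq σ] (G : Gen (d := d) (L := L) B σ)
    (P : G.I → Prop) [DecidablePred P] (F : G.CIdx → ℝ) :
    ∑ j ∈ Finset.univ.filter (fun j : G.CIdx => P j.2.2.1), F j =
      ∑ e : Edge d L, ∑ a : B.ι, ∑ i ∈ Finset.univ.filter P, ∑ p : Site d L × Fin d × Fin d, ∑ b : Bool,
        ∑ c : Fin n × Fin n × Fin n × Fin n, ∑ mo : G.CModes i p b, F ⟨e, a, i, p, b, c, mo⟩ := by
  rw [Finset.sum_filter, G.sum_CIdx]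
  refine Finset.sum_congr rfl fun e _ => Finset.sum_congr rfl fun a _ => ?_
  rw [Finset.sum_filter]
  refine Finset.sum_congr rfl fun i _ => ?_
  split_ifs with hi
  · rfl
  · simp

/-- The constant produced by the anchored step: minus the zero-mode children of root `e₀` at `𝟙`. [ours] -/
def anchStepConst (k : ℕ) (e₀ : Edge d L) : ℝ :=
  -∑ j ∈ Finset.univ.filter (fun j : (pack (d := d) (L := L) B k).G.CIdx => root B k j.2.2.1 = e₀),
    if (pack (d := d) (L := L) B k).G.step.cm j = 0 then
      (pack (d := d) (L := L) B k).G.childF j (WilsonFlow.coeConfig fun _ => 1) else 0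

/-- **The vertex, summed over one root**: on the field manifold,
`-∑ₑ∑ₐ ∂^a_e S · ∂^a_e G'^{(k)}_{e₀} = ∑_{children of root e₀} childF`. [ours] -/
theorem vertex_sum_root (k : ℕ) (e₀ : Edge d L) (U : GaugeConfig d L (Matrix.specialUnitaryGroup (Fin n) ℂ)) :
    -(∑ e : Edge d L, ∑ a : B.ι, linkDeriv e (B.T a) (ambWilsonAction : AmbConfig d L n → ℝ)
        (WilsonFlow.coeConfig U) * linkDeriv e (B.T a) (anchSk (d := d) (L := L) B k e₀) (WilsonFlow.coeConfig U))
      = ∑ j ∈ Finset.univ.filter (fun j : (pack (d := d) (L := L) B k).G.CIdx => root B k j.2.2.1 = e₀),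
          (pack (d := d) (L := L) B k).G.childF j (WilsonFlow.coeConfig U) := by
  set G := (pack (d := d) (L := L) B k).G with hG
  rw [sum_filter_parent B G (fun i => root B k i = e₀)]
  simp only [linkDeriv_anchSk, Finset.mul_sum, ← Finset.sum_neg_distrib]
  refine Finset.sum_congr rfl fun e _ => Finset.sum_congr rfl fun a _ => Finset.sum_congr rfl fun i _ => ?_
  rw [Gen.term, vertex B (G.lnk i) (G.pol i) (G.z i) (G.x i) (G.y i) e a]
  refine Finset.sum_congr rfl fun p _ => ?_
  split_ifs with hp
  · refine Finset.sum_congr rfl fun b _ => Finset.sum_congr rfl fun c _ => ?_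
    simp only [Gen.childF, Gen.step, Gen.y, Gen.zhalf, if_pos hp, Gen.clnk, Gen.cpol, Gen.cx, Gen.cv]
    exact termF_coeConfig_eq_sum _ _ B _ _ _ U
  · symm
    refine Finset.sum_eq_zero fun b _ => Finset.sum_eq_zero fun c _ => Finset.sum_eq_zero fun mo _ => ?_
    simp only [Gen.childF, Gen.zhalf, if_neg hp]
    exact Gen.termF_zero_left _ _ _ _ _

/-- **Anchored recursion step on the field manifold**:
`Δ G'^{(k+1)}_{e₀}(ιU) = -∑ₑ∑ₐ ∂^a_e S · ∂^a_e G'^{(k)}_{e₀}(ιU) + const`. [ours] -/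
theorem linkLap_anchSk_succ_coeConfig (k : ℕ) (e₀ : Edge d L)
    (U : GaugeConfig d L (Matrix.specialUnitaryGroup (Fin n) ℂ)) :
    linkLap B (anchSk (d := d) (L := L) B (k + 1) e₀) (WilsonFlow.coeConfig U)
      = -(∑ e : Edge d L, ∑ a : B.ι, linkDeriv e (B.T a) (ambWilsonAction : AmbConfig d L n → ℝ)
          (WilsonFlow.coeConfig U) * linkDeriv e (B.T a) (anchSk (d := d) (L := L) B k e₀) (WilsonFlow.coeConfig U))
        + anchStepConst (d := d) (L := L) B k e₀ := by
  rw [vertex_sum_root, linkLap_anchSk, anchStepConst, ← sub_eq_add_neg, ← Finset.sum_sub_distrib]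
  show ∑ j ∈ Finset.univ.filter (fun j : (pack (d := d) (L := L) B k).G.CIdx => root B k j.2.2.1 = e₀),
      (pack (d := d) (L := L) B k).G.step.cm j * (pack (d := d) (L := L) B k).G.step.term j (WilsonFlow.coeConfig U)
    = _
  refine Finset.sum_congr rfl fun j _ => ?_
  rw [cm_mul_term_step B]
  split_ifs with h
  · rw [(pack (d := d) (L := L) B k).G.childF_coeConfig_eq_of_cm_eq_zero j h U]; ring
  · ring

end Step

/-! ## §3. The anchored terms of the tree's series have the anchored graded gradients -/

section Anchored
variable (B : SuBasis n)

/-- The constants of the anchored graded recursion. [ours] -/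
def anchConst (e₀ : Edge d L) : ℕ → ℝ
  | 0 => anchConst0 (d := d) (L := L) B e₀
  | k + 1 => anchStepConst (d := d) (L := L) B k e₀

/-- The constants of the tree's anchored recursion (`solvePD` subtracts the trivial-measure mean). [ours] -/
def anchTermConst (e₀ : Edge d L) : ℕ → ℝ
  | 0 => -∫ U', anchorS (n := n) e₀ (WilsonFlow.coeConfig U')
      ∂(trivialMeasure (Matrix.specialUnitaryGroup (Fin n) ℂ) d L)
  | k + 1 => ∫ U', wilsonRhs B (anchTerm B k e₀) (WilsonFlow.coeConfig U')
      ∂(trivialMeasure (Matrix.specialUnitaryGroup (Fin n) ℂ) d L)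

/-- **The anchored terms `G^{(k)}_{e₀}` of the tree's Lüscher series and the anchored graded pieces
`G'^{(k)}_{e₀}` have the same link gradients on `SU(n)^E`** (and the same constants). [ours] -/
theorem linkDeriv_anchTerm_eq (e₀ : Edge d L) (k : ℕ) :
    anchTermConst (d := d) (L := L) B e₀ k = anchConst (d := d) (L := L) B e₀ k ∧
    ∀ (e : Edge d L) (a : B.ι) (U : GaugeConfig d L (Matrix.specialUnitaryGroup (Fin n) ℂ)),
      linkDeriv e (B.T a) (anchTerm B k e₀) (WilsonFlow.coeConfig U) =
        linkDeriv e (B.T a) (anchSk (d := d) (L := L) B k e₀) (WilsonFlow.coeConfig U) := by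
  refine linkDeriv_eq_of_driven B (S := (ambWilsonAction : AmbConfig d L n → ℝ)) (src := anchorS e₀)
    (F := fun k => anchTerm B k e₀) (G := fun k => anchSk (d := d) (L := L) B k e₀)
    (fun k => contDiff_anchTerm B k e₀) (fun k => contDiff_anchSk B k e₀) ?_ ?_ ?_ ?_ k
  · intro U
    rw [anchTerm_zero, linkLap_solvePD]
    rfl
  · intro U
    exact linkLap_anchSk_zero_coeConfig B e₀ U
  · intro k U
    show linkLap B (anchTerm B (k + 1) e₀) (WilsonFlow.coeConfig U) = _
    rw [anchTerm_succ, linkLap_solvePD]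
    simp only [Pi.neg_apply, wilsonRhs, MeasureTheory.integral_neg]
    rw [sub_neg_eq_add]
    rfl
  · intro k U
    exact linkLap_anchSk_succ_coeConfig B k e₀ U

/-! ## §4. The anchored bound -/

/-- The gradient of an anchored piece is bounded by the link mass of the whole generation:
`|∂^a_e G'^{(k)}_{e₀}(ιU)| ≤ N_{G_k}(e)`. [ours] -/
theorem abs_linkDeriv_anchSk_le (k : ℕ) (e₀ e : Edge d L) (a : B.ι)
    (U : GaugeConfig d L (Matrix.specialUnitaryGroup (Fin n) ℂ)) :
    |linkDeriv e (B.T a) (anchSk (d := d) (L := L) B k e₀) (WilsonFlow.coeConfig U)|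
      ≤ (pack (d := d) (L := L) B k).G.mass e := by
  set G := (pack (d := d) (L := L) B k).G with hG
  rw [linkDeriv_anchSk]
  refine (Finset.abs_sum_le_sum_abs _ _).trans ?_
  have h1 : ∑ i ∈ Finset.univ.filter (fun i => root B k i = e₀),
      |linkDeriv e (B.T a) (G.term i) (WilsonFlow.coeConfig U)|
        ≤ ∑ i ∈ Finset.univ.filter (fun i => root B k i = e₀), G.wt i e * G.nu i :=
    Finset.sum_le_sum fun i _ => G.abs_linkDeriv_term_le i e a U
  have h2 : ∑ i ∈ Finset.univ.filter (fun i => root B k i = e₀), G.wt i e * G.nu i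
      ≤ ∑ i, G.wt i e * G.nu i :=
    Finset.sum_le_univ_sum_of_nonneg fun i => mul_nonneg (G.wt_nonneg i e) (G.nu_nonneg i)
  have h3 : ∑ i, G.wt i e * G.nu i = G.mass e := by
    unfold Gen.mass Gen.live
    rw [Finset.sum_filter_of_ne]
    intro i _ hi hc
    apply hi
    have : G.nu i = 0 := by
      unfold Gen.nu; rw [pack_z_eq_zero B k i hc, norm_zero, zero_mul]
    rw [this, mul_zero]
  exact h1.trans (h2.trans h3.le)

/-- **Geometric bound on the anchored terms of the tree's series** (`n ≠ 0`):
`|∂^a_e G^{(k)}_{e₀}(ιU)| ≤ N₀ θ₁^k` for every volume, order, anchor, link and direction. [ours] -/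
theorem abs_linkDeriv_anchTerm_le (hn : n ≠ 0) (k : ℕ) (e₀ e : Edge d L) (a : B.ι)
    (U : GaugeConfig d L (Matrix.specialUnitaryGroup (Fin n) ℂ)) :
    |linkDeriv e (B.T a) (anchTerm B k e₀) (WilsonFlow.coeConfig U)| ≤ N0 d n * theta1 d n B ^ k := by
  rw [(linkDeriv_anchTerm_eq B e₀ k).2 e a U]
  exact (abs_linkDeriv_anchSk_le B k e₀ e a U).trans (mass_pack_le B hn k e)

end Anchored

/-- **THE ANCHORED THEOREM A (ours; PROVED).**  `LuscherAnchoredGeometricBound d n B₀` — the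
`@[conjecture]` node of `TheoremAReduction.lean` — holds for every `d`, `n` and orthonormal basis `B₀` of
`𝔰𝔲(n)`: with `ρ = 1/θ₁(d,n,B₀)` and `C = N₀(d,n)` (the constants of `GradedTheoremA`), the anchored terms
`G^{(k)}_{e₀}` of the tree's Lüscher series of the Wilson action (each supported on the plaquette ball
`linkBall (k+1) e₀`) satisfy `|∂^a_e G^{(k)}_{e₀}(ιU)| ≤ C ρ^{-k}` at every lattice size `L`, order `k`,
anchor `e₀`, link `e`, direction `a` and `U ∈ SU(n)^E`.  (`n = 0`: no directions, vacuous.) [ours] -/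
theorem luscherAnchoredGeometricBound_holds (d n : ℕ) (B₀ : SuBasis n) : LuscherAnchoredGeometricBound d n B₀ := by
  by_cases hn : n = 0
  · subst hn
    exact ⟨1, one_pos, 0, fun L _ k e₀ e U a => ((isEmpty_ι_of_zero B₀).false a).elim⟩
  · refine ⟨(theta1 d n B₀)⁻¹, inv_pos.2 (lt_of_lt_of_le one_pos (one_le_theta1 d n B₀)), N0 d n,
      fun L _ k e₀ e U a => ?_⟩
    rw [inv_inv]
    exact abs_linkDeriv_anchTerm_le B₀ hn k e₀ e a U

end Summit.Ventures.LatticeQCDFlow.TrivializingMaps.GradedSeries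

end
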